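import Summits.ABC.ABC.Theorems.IsogenyGlueCongruencePolyDegreeOfBoundedPrimesHeightCalibration

/-!
# Stub `stub_degLeOfHeight` of crux B (`PolyDegreeOfBoundedPrimes`, stmt-ABC-2046, line `Sketch`)

The PER-DATUM form of Murty 1999, Thm 1 (ii) / §2 with a free exponent (the per-datum twin of the
landed `polyDegree_of_polyHeight_of_manin`): given real constants `σ, C_H, M` there are `κ, K`
(depending only on them and on the two absolute constants of the tree's Silverman and Petersson
inequalities) such that for every square-free level `N`, every elliptic `W/ℚ` (ANY Weierstrass model,
no minimality) and every modular parametrisation datum `D` of `W` at level `N`,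

  `max(|Δ_W|, |c₄(W)|³) ≤ C_H · N^σ` and `|c_D| ≤ M` imply `deg D ≤ K · N^κ`,

with `κ = 3/2 + max(σ,0)/6`. Proof: Zagier's identity `4π² c² (f,f) = deg · covol(Λ)`
(`zagier_degree_formula_holds`); the Petersson UPPER bound at square-free level
`(f,f) ≤ C_P · N (1 + log N)⁵ ≤ C₂ N^{3/2}` (`Automorphic.exists_petersson_le_mul_log_pow_of_squarefree`,
`log_add_one_pow_five_le`); Silverman's lower covolume inequality on every model
`covol^{−6} ≤ A · max(|c₄|³, |c₆|²)` (`covolume_rpow_neg_six_le_of_isNeronLatticeOf`) with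
`max(|c₄|³, |c₆|²) ≤ 1729 · max(|Δ|, |c₄|³)` (`HeightCalibration.max_abs_c₄_c₆_le_rat`); and the
bookkeeping `inv_le_of_rpow_neg_six_le`, `deg_le_of_zagier_of_upper`. All inputs are theorems of the
tree; no named fact is used. Supports stmt-ABC-2046.

References: M. R. Murty, *Bounds for congruence primes* (1999), Thm 1 (ii) and §2; J. Silverman,
*Heights and elliptic curves* (1986), Cor. 2.3.
-/

noncomputable section

-- single-conjunct summit ABC: the duplicate ABC.ABC is mandated (CONVENTIONS §2)
set_option linter.dupNamespace false

namespace Summit.ABC.ABC.Theorems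

open Literature.NumberTheory.EllipticCurves Literature.NumberTheory.EllipticCurves.ModularForms
open CongruenceSubgroup

/-- **Per-datum Murty bound (Murty 1999 Thm 1 (ii) / §2 with a free exponent).** For real constants
`σ, C_H, M` there are `κ, K` such that for every square-free `N`, every elliptic `W/ℚ` and every
modular parametrisation datum `D` of `W` at level `N`: if `max(|Δ_W|, |c₄(W)|³) ≤ C_H · N^σ` and the
Manin constant satisfies `|c_D| ≤ M`, then `deg D ≤ K · N^κ` (here `κ = 3/2 + max(σ,0)/6` and
`K = 4π² · max(M,0)² · C₂ · B^{1/6}`). Proof: Zagier `4π² c² (f,f) = deg · covol`;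
`(f,f) ≤ C_P N (1 + log N)⁵ ≤ C₂ N^{3/2}` at square-free level (tree theorem);
`covol⁻¹ ≤ (1729 A C_H)^{1/6} N^{σ/6}` from Silverman's lower covolume inequality (valid on every
model) and `max(|c₄|³,|c₆|²) ≤ 1729 · max(|Δ|,|c₄|³)`; `deg = 4π² c² (f,f) / covol`. Per-datum form of
`polyDegree_of_polyHeight_of_manin`. (Registered stub of stmt-ABC-2046, line `Sketch`: name + one-line
signature verbatim.) [cite: MurtyCongruencePrimes1999, Thm. 1 (ii) and §2] -/
theorem stub_degLeOfHeight : ∀ σ CH M : ℝ, ∃ κ K : ℝ, ∀ (N : ℕ) [NeZero N] (W : WeierstrassCurve ℚ) [W.IsElliptic] (D : Literature.NumberTheory.EllipticCurves.ModularForms.ModularParametrizationData W N), Squarefree N → ((max |W.Δ| (|W.c₄| ^ 3) : ℚ) : ℝ) ≤ CH * (N : ℝ) ^ σ → |(D.maninConstant : ℝ)| ≤ M → (D.modularDegree : ℝ) ≤ K * (N : ℝ) ^ κ := by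
  intro σ CH M
  obtain ⟨A, hA, hSil⟩ := covolume_rpow_neg_six_le_of_isNeronLatticeOf
  obtain ⟨CP, hCP, hPet⟩ :=
    Literature.NumberTheory.Automorphic.exists_petersson_le_mul_log_pow_of_squarefree
  -- constants
  set B : ℝ := A * (1729 * max CH 0) with hB
  have hB0 : 0 ≤ B := by positivity
  have hhalf : (0 : ℝ) < 1 / 2 := by norm_num
  set C₂ : ℝ := CP * (5 / (1 / 2 : ℝ) + 1) ^ 5 with hC₂
  set M' : ℝ := max M 0 with hM'
  set K : ℝ := 4 * Real.pi ^ 2 * M' ^ 2 * C₂ * B ^ (1 / 6 : ℝ) with hK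
  refine ⟨(1 + 1 / 2) + max σ 0 / 6, K, fun N _ W _ D hsq hσ hDc ↦ ?_⟩
  have hNpos : (0 : ℝ) < N := by exact_mod_cast Nat.pos_of_ne_zero (NeZero.ne N)
  have hN1 : (1 : ℝ) ≤ N := by exact_mod_cast Nat.pos_of_ne_zero (NeZero.ne N)
  -- Zagier's identity, real form
  have hZ := congrArg Complex.re D.zagier_degree_formula_holds
  rw [Complex.re_ofReal_mul, Complex.ofReal_re] at hZ
  have hP0 : 0 ≤ (peterssonProduct (Gamma0 N) 2 D.f D.f).re :=
    D.zagier_degree_formula_holds.peterssonProduct_re_pos.le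
  have hcov : 0 < ZLattice.covolume D.L.lattice := ZLattice.covolume_pos _ _
  -- Petersson upper bound at square-free level: `(f,f) ≤ CP · N (1 + log N)⁵ ≤ C₂ N^{3/2}`
  have hP : (peterssonProduct (Gamma0 N) 2 D.f D.f).re ≤ C₂ * (N : ℝ) ^ (1 + 1 / 2 : ℝ) := by
    have h1 := hPet N hsq W D.f D.isNewformOf
    have hlog : (1 + Real.log N) ^ 5 ≤ (5 / (1 / 2 : ℝ) + 1) ^ 5 * (N : ℝ) ^ (1 / 2 : ℝ) := by
      rw [add_comm]
      exact log_add_one_pow_five_le hN1 hhalf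
    have hNrpow : (N : ℝ) * (N : ℝ) ^ (1 / 2 : ℝ) = (N : ℝ) ^ (1 + 1 / 2 : ℝ) := by
      rw [Real.rpow_add hNpos, Real.rpow_one]
    calc (peterssonProduct (Gamma0 N) 2 D.f D.f).re ≤ CP * N * (1 + Real.log N) ^ 5 := h1
      _ ≤ CP * N * ((5 / (1 / 2 : ℝ) + 1) ^ 5 * (N : ℝ) ^ (1 / 2 : ℝ)) :=
          mul_le_mul_of_nonneg_left hlog (by positivity)
      _ = C₂ * ((N : ℝ) * (N : ℝ) ^ (1 / 2 : ℝ)) := by rw [hC₂]; ring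
      _ = C₂ * (N : ℝ) ^ (1 + 1 / 2 : ℝ) := by rw [hNrpow]
  -- the height hypothesis: `max(|c₄|³,|c₆|²) ≤ 1729 · max(|Δ|,|c₄|³) ≤ 1729 · max CH 0 · N^{max σ 0}`
  have hmax : ((max (|W.c₄| ^ 3) (|W.c₆| ^ 2) : ℚ) : ℝ) ≤
      1729 * max CH 0 * (N : ℝ) ^ (max σ 0) := by
    have h1 : ((max (|W.c₄| ^ 3) (|W.c₆| ^ 2) : ℚ) : ℝ) ≤
        ((1729 * max |W.Δ| (|W.c₄| ^ 3) : ℚ) : ℝ) := by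
      exact_mod_cast HeightCalibration.max_abs_c₄_c₆_le_rat W
    have hNσ : (N : ℝ) ^ σ ≤ (N : ℝ) ^ (max σ 0) :=
      Real.rpow_le_rpow_of_exponent_le hN1 (le_max_left _ _)
    have h2 : ((max |W.Δ| (|W.c₄| ^ 3) : ℚ) : ℝ) ≤ max CH 0 * (N : ℝ) ^ (max σ 0) :=
      calc ((max |W.Δ| (|W.c₄| ^ 3) : ℚ) : ℝ) ≤ CH * (N : ℝ) ^ σ := hσ
        _ ≤ max CH 0 * (N : ℝ) ^ σ := mul_le_mul_of_nonneg_right (le_max_left _ _) (by positivity)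
        _ ≤ max CH 0 * (N : ℝ) ^ (max σ 0) := mul_le_mul_of_nonneg_left hNσ (le_max_right _ _)
    calc ((max (|W.c₄| ^ 3) (|W.c₆| ^ 2) : ℚ) : ℝ)
        ≤ ((1729 * max |W.Δ| (|W.c₄| ^ 3) : ℚ) : ℝ) := h1
      _ = 1729 * ((max |W.Δ| (|W.c₄| ^ 3) : ℚ) : ℝ) := by push_cast; ring
      _ ≤ 1729 * (max CH 0 * (N : ℝ) ^ (max σ 0)) := mul_le_mul_of_nonneg_left h2 (by norm_num)
      _ = 1729 * max CH 0 * (N : ℝ) ^ (max σ 0) := by ring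
  -- Silverman on the model `W` (no minimality needed): `covol^{-6} ≤ A · max(|c₄|³,|c₆|²) ≤ B · (N^{max σ 0 / 6})⁶`
  have hpow : (N : ℝ) ^ (max σ 0) = ((N : ℝ) ^ (max σ 0 / 6)) ^ 6 := by
    rw [← Real.rpow_natCast, ← Real.rpow_mul hNpos.le]
    congr 1
    push_cast
    ring
  have h6 : ZLattice.covolume D.L.lattice ^ (-(6 : ℝ)) ≤ B * ((N : ℝ) ^ (max σ 0 / 6)) ^ 6 := by
    calc ZLattice.covolume D.L.lattice ^ (-(6 : ℝ))
        ≤ A * ((max (|W.c₄| ^ 3) (|W.c₆| ^ 2) : ℚ) : ℝ) := hSil W D.L D.isNeronLattice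
      _ ≤ A * (1729 * max CH 0 * (N : ℝ) ^ (max σ 0)) := mul_le_mul_of_nonneg_left hmax hA.le
      _ = B * ((N : ℝ) ^ (max σ 0 / 6)) ^ 6 := by rw [hB, hpow]; ring
  have hinv := inv_le_of_rpow_neg_six_le hcov hB0 (by positivity) h6
  -- the Manin constant: `|c| ≤ M ≤ max M 0`
  have hcM : |(D.c : ℝ)| ≤ M' :=
    calc |(D.c : ℝ)| = |(D.maninConstant : ℝ)| := rfl
      _ ≤ M := hDc
      _ ≤ M' := le_max_left _ _
  -- the degree bound
  have hdeg := deg_le_of_zagier_of_upper hcov hZ hcM hP0 hP hinv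
  have hexp : (N : ℝ) ^ (1 + 1 / 2 : ℝ) * (N : ℝ) ^ (max σ 0 / 6) =
      (N : ℝ) ^ ((1 + 1 / 2) + max σ 0 / 6) := by
    rw [← Real.rpow_add hNpos]
  calc (D.modularDegree : ℝ) = (D.deg : ℝ) := rfl
    _ ≤ 4 * Real.pi ^ 2 * M' ^ 2 * (C₂ * (N : ℝ) ^ (1 + 1 / 2 : ℝ)) *
          (B ^ (1 / 6 : ℝ) * (N : ℝ) ^ (max σ 0 / 6)) := hdeg
    _ = K * ((N : ℝ) ^ (1 + 1 / 2 : ℝ) * (N : ℝ) ^ (max σ 0 / 6)) := by rw [hK]; ring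
    _ = K * (N : ℝ) ^ ((1 + 1 / 2) + max σ 0 / 6) := by rw [hexp]

end Summit.ABC.ABC.Theorems

end
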